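import Mathlib
import Summits.MatrixMultiplication.MatrixMultiplication.Theorems.FourierTwoFamiliesModPPrimeTwoFamiliesLadderShapes
import Summits.MatrixMultiplication.MatrixMultiplication.Theorems.FourierTwoFamiliesModPPrimeTwoFamiliesLadderReverse

/-!
# Shape diversity of near-apex ladders (line `Sketch`, crux stmt-MatrixMultiplication-14308)

The crux (CKSU 2005 Conj. 4.7 with prime cyclic hosts) is equivalent to the cyclic LADDER conjecture
(line `Sketch`): ordered families `(X c, Y c)_{c<r}` in `ℤ/m` with every class direct (hW) and
one-directional separation (hL: for `p < q` the lower cross differences `Y q - X p` avoid every diagonal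
difference set `Y c - X c`), with `r ≥ m^{1/2-ε}` classes of co-volume `|X c||Y c| ≥ m^{1-ε}`.

This file turns the landed SHAPE PACKING for ladders (`ladder_sum_card_mul_card_le_of_subshape`,
`ladder_sum_card_mul_le_of_rightShapes`: `K` right templates pack `K` times) and the ladder duality
(`isLadder_reverse`: swap sides, reverse the order) into the quantitative DESIGN RULE for the open stub:

* `ladder_sum_card_mul_le_of_leftShapes` — the same packing for the `X`-sides;
* `ladder_rpow_le_rightShapes` / `ladder_rpow_le_leftShapes` — a ladder level of the conjecture's slice
  `ε` (`m^{1/2-ε} ≤ r`, `m^{1-ε} ≤ |X c||Y c|`) whose `Y`-sides (resp. `X`-sides) are translates of at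
  most `K` templates has `m^{1/2-2ε} ≤ K`.

So near the apex essentially ALL classes must be pairwise non-translates on EACH side: translate
designs, bounded menus and every "one template, many shifts" alphabet are excluded for `ε < 1/4`
(the one-directional counterpart of `Negative/Shapes.rpow_le_rightShapes_of_witness` for the crux).
-/

-- single-conjunct summit: the mandated namespace repeats `MatrixMultiplication` (summit = sub-problem).
set_option linter.dupNamespace false

namespace Summit.MatrixMultiplication.MatrixMultiplication.Theorems.PrimeTwoFamilies.LadderLift

open Finset
open scoped Pointwise

/-- **`K` left shapes pack `K` times (ladders).**  If the `X`-sides of a ladder are translates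
`u c +ᵥ X₀ (κ c)` of at most `K` templates then `Σ_c |X c|·|Y c| ≤ K·|G|` — the right-shape packing
applied to the reversed dual ladder `(Y ∘ rev, X ∘ rev)` (`isLadder_reverse`). -/
theorem ladder_sum_card_mul_le_of_leftShapes {G : Type*} [AddCommGroup G] [Fintype G] [DecidableEq G]
    {r K : ℕ} (X Y : Fin r → Finset G)
    (hW : ∀ c : Fin r, ∀ x ∈ X c, ∀ x' ∈ X c, ∀ y ∈ Y c, ∀ y' ∈ Y c,
      (x - x') + (y - y') = 0 → x = x' ∧ y = y')
    (hL : ∀ c p q : Fin r, p < q → ∀ x ∈ X c, ∀ y ∈ Y c, ∀ x' ∈ X p, ∀ y' ∈ Y q, y - x ≠ y' - x')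
    (X₀ : Fin K → Finset G) (κ : Fin r → Fin K) (u : Fin r → G) (hX : ∀ c, X c = u c +ᵥ X₀ (κ c)) :
    ∑ c, (X c).card * (Y c).card ≤ K * Fintype.card G := by
  obtain ⟨hW', hL'⟩ := isLadder_reverse X Y hW hL
  have h := ladder_sum_card_mul_le_of_rightShapes (fun c => Y (Fin.rev c)) (fun c => X (Fin.rev c))
    hW' hL' X₀ (κ ∘ Fin.rev) (u ∘ Fin.rev) (fun c => hX (Fin.rev c))
  calc ∑ c, (X c).card * (Y c).card
      = ∑ c, (Y (Fin.rev c)).card * (X (Fin.rev c)).card := by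
        rw [← Equiv.sum_comp Fin.revPerm (fun c => (X c).card * (Y c).card)]
        refine Finset.sum_congr rfl fun c _ => ?_
        rw [Fin.revPerm_apply, mul_comm]
    _ ≤ K * Fintype.card G := h

/-- **Shape diversity, right side.**  A ladder level of the cyclic ladder conjecture's slice `ε`
in `ZMod m` — `m^{1/2-ε} ≤ r` classes, co-volumes `m^{1-ε} ≤ |X c||Y c|` — whose `Y`-sides are
translates of at most `K` templates has `m^{1/2-2ε} ≤ K`
(`r·m^{1-ε} ≤ Σ_c |X c||Y c| ≤ K·m`). -/
theorem ladder_rpow_le_rightShapes {m : ℕ} [NeZero m] {r K : ℕ} (X Y : Fin r → Finset (ZMod m))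
    (hW : ∀ c : Fin r, ∀ x ∈ X c, ∀ x' ∈ X c, ∀ y ∈ Y c, ∀ y' ∈ Y c,
      (x - x') + (y - y') = 0 → x = x' ∧ y = y')
    (hL : ∀ c p q : Fin r, p < q → ∀ x ∈ X c, ∀ y ∈ Y c, ∀ x' ∈ X p, ∀ y' ∈ Y q, y - x ≠ y' - x')
    (Y₀ : Fin K → Finset (ZMod m)) (κ : Fin r → Fin K) (u : Fin r → ZMod m)
    (hY : ∀ c, Y c = u c +ᵥ Y₀ (κ c))
    {ε : ℝ} (hr : (m : ℝ) ^ (1 / 2 - ε) ≤ (r : ℝ))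
    (hP : ∀ c : Fin r, (m : ℝ) ^ (1 - ε) ≤ (((X c).card * (Y c).card : ℕ) : ℝ)) :
    (m : ℝ) ^ (1 / 2 - 2 * ε) ≤ (K : ℝ) := by
  have hsum := ladder_sum_card_mul_le_of_rightShapes X Y hW hL Y₀ κ u hY
  rw [ZMod.card] at hsum
  have hmpos : (0 : ℝ) < m := by exact_mod_cast Nat.pos_of_ne_zero (NeZero.ne m)
  have h1 : (r : ℝ) * (m : ℝ) ^ (1 - ε) ≤ (K : ℝ) * (m : ℝ) := by
    calc (r : ℝ) * (m : ℝ) ^ (1 - ε) = ∑ _c : Fin r, (m : ℝ) ^ (1 - ε) := by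
          rw [Finset.sum_const, Finset.card_univ, Fintype.card_fin, nsmul_eq_mul]
      _ ≤ ∑ c : Fin r, (((X c).card * (Y c).card : ℕ) : ℝ) := Finset.sum_le_sum fun c _ => hP c
      _ = ((∑ c : Fin r, (X c).card * (Y c).card : ℕ) : ℝ) := by push_cast; rfl
      _ ≤ ((K * m : ℕ) : ℝ) := by exact_mod_cast hsum
      _ = (K : ℝ) * (m : ℝ) := by push_cast; rfl
  have h2 : (m : ℝ) ^ (1 / 2 - ε) * (m : ℝ) ^ (1 - ε) ≤ (K : ℝ) * (m : ℝ) :=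
    (mul_le_mul_of_nonneg_right hr (Real.rpow_nonneg hmpos.le _)).trans h1
  have h3 : (m : ℝ) ^ (1 / 2 - ε) * (m : ℝ) ^ (1 - ε) = (m : ℝ) ^ (1 / 2 - 2 * ε) * (m : ℝ) := by
    rw [← Real.rpow_add hmpos, show (1 / 2 - ε + (1 - ε) : ℝ) = (1 / 2 - 2 * ε) + 1 by ring,
      Real.rpow_add hmpos, Real.rpow_one]
  rw [h3] at h2
  exact le_of_mul_le_mul_right h2 hmpos

/-- **Shape diversity, left side**: the same with the `X`-sides translates of at most `K`
templates (`ladder_sum_card_mul_le_of_leftShapes`). -/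
theorem ladder_rpow_le_leftShapes {m : ℕ} [NeZero m] {r K : ℕ} (X Y : Fin r → Finset (ZMod m))
    (hW : ∀ c : Fin r, ∀ x ∈ X c, ∀ x' ∈ X c, ∀ y ∈ Y c, ∀ y' ∈ Y c,
      (x - x') + (y - y') = 0 → x = x' ∧ y = y')
    (hL : ∀ c p q : Fin r, p < q → ∀ x ∈ X c, ∀ y ∈ Y c, ∀ x' ∈ X p, ∀ y' ∈ Y q, y - x ≠ y' - x')
    (X₀ : Fin K → Finset (ZMod m)) (κ : Fin r → Fin K) (u : Fin r → ZMod m)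
    (hX : ∀ c, X c = u c +ᵥ X₀ (κ c))
    {ε : ℝ} (hr : (m : ℝ) ^ (1 / 2 - ε) ≤ (r : ℝ))
    (hP : ∀ c : Fin r, (m : ℝ) ^ (1 - ε) ≤ (((X c).card * (Y c).card : ℕ) : ℝ)) :
    (m : ℝ) ^ (1 / 2 - 2 * ε) ≤ (K : ℝ) := by
  have hsum := ladder_sum_card_mul_le_of_leftShapes X Y hW hL X₀ κ u hX
  rw [ZMod.card] at hsum
  have hmpos : (0 : ℝ) < m := by exact_mod_cast Nat.pos_of_ne_zero (NeZero.ne m)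
  have h1 : (r : ℝ) * (m : ℝ) ^ (1 - ε) ≤ (K : ℝ) * (m : ℝ) := by
    calc (r : ℝ) * (m : ℝ) ^ (1 - ε) = ∑ _c : Fin r, (m : ℝ) ^ (1 - ε) := by
          rw [Finset.sum_const, Finset.card_univ, Fintype.card_fin, nsmul_eq_mul]
      _ ≤ ∑ c : Fin r, (((X c).card * (Y c).card : ℕ) : ℝ) := Finset.sum_le_sum fun c _ => hP c
      _ = ((∑ c : Fin r, (X c).card * (Y c).card : ℕ) : ℝ) := by push_cast; rfl
      _ ≤ ((K * m : ℕ) : ℝ) := by exact_mod_cast hsum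
      _ = (K : ℝ) * (m : ℝ) := by push_cast; rfl
  have h2 : (m : ℝ) ^ (1 / 2 - ε) * (m : ℝ) ^ (1 - ε) ≤ (K : ℝ) * (m : ℝ) :=
    (mul_le_mul_of_nonneg_right hr (Real.rpow_nonneg hmpos.le _)).trans h1
  have h3 : (m : ℝ) ^ (1 / 2 - ε) * (m : ℝ) ^ (1 - ε) = (m : ℝ) ^ (1 / 2 - 2 * ε) * (m : ℝ) := by
    rw [← Real.rpow_add hmpos, show (1 / 2 - ε + (1 - ε) : ℝ) = (1 / 2 - 2 * ε) + 1 by ring,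
      Real.rpow_add hmpos, Real.rpow_one]
  rw [h3] at h2
  exact le_of_mul_le_mul_right h2 hmpos

end Summit.MatrixMultiplication.MatrixMultiplication.Theorems.PrimeTwoFamilies.LadderLift
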